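import Mathlib
import HarnessLib
import Summits.NavierStokesRegularity.NavierStokesRegularity.Theorems.PoloidalWindowDoorPoloidalWindowRigidityConstantShearEnergy
import Summits.NavierStokesRegularity.NavierStokesRegularity.Theorems.PoloidalWindowDoorPoloidalWindowRigidityConstantShearSlice

/-!
# Route `PoloidalWindowDoor`, crux `PoloidalWindowRigidity` (K2, stmt-NavierStokesRegularity-19708) —
# the CONSTANT-SHEAR («wave») stratum: the horizontal variance of `v₂` as a function of `(t, z)`

Cell ns-regularity-ideate, seat ns-poloidal-K2-p2 (stub-worker, gen 2; support lemmas `--supports` the crux,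
`--as helper`).  Fourth brick of the (M)-consuming exclusion of `∂₂v_h ≡ μ∇_h v₂` (`μ < 1` constant).  For a profile
`v` of the route's Type-I class on the stratum, and horizontal means at scale `R` (bump `φ`, centre `0`), the slice
quantities of `…ConstantShearMeans/Energy` become functions of `(t, z)`:
`V = ⟨v₂²⟩ − ⟨v₂⟩²` (horizontal variance, `sliceV`), `G = ½⟨v₂³⟩ − ⟨v₂⟩⟨v₂²⟩ + ½⟨v₂⟩³` (flux, `sliceG`),
`D = ⟨|∇_h v₂|²⟩` (`sliceD`), with their derivative values `sliceVt`, `sliceGz`.  Proved here: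

* `hasDerivAt_sliceV` (`∂ₜV = sliceVt`), `hasDerivAt_sliceG` (`∂_zG = sliceGz`) — differentiation under the
  horizontal integral (`…HorizontalMean`);
* `sliceV_nonneg`, `sliceV_le`, `abs_sliceG_le` (`|G| ≤ (3/2)(C/√(−t))V`), `sliceD_nonneg`, `abs_sliceVt_le`,
  `abs_sliceGz_le`;
* `key_slice` — THE KEY INEQUALITY on the stratum: `∂ₜV + 2∂_zG + 2(1−μ)D ≤ K(t)/R` for every `t < 0`, `z`, with
  `K(t) = (8M₀³ + (4+2|1−μ|)M₀M₁)(‖∂₀φ̄‖₁+‖∂₁φ̄‖₁)`, `M₀ = C/√(−t)`, `M₁ = C₁/(−t)` (the NS residual enters through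
  K2-p3's separated pressure: `f₂` depends on the height only, so the pressure work factors through the mean);

WHAT THIS IS NOT: not a claim about Navier–Stokes regularity and not the open residue S2⁗ — bookkeeping for one
located stratum of a door route's Type-I Liouville problem (bears_on LADDER-NS N0, rung N0-LocalTubeDoorPoloidal).
-/

noncomputable section

-- the summit and its single sub-problem share the name (CONVENTIONS §1), as in every Theorems file
set_option linter.dupNamespace false

namespace Summit.NavierStokesRegularity.NavierStokesRegularity.Theorems.PoloidalWindowDoorPoloidalWindowRigidityConstantShearVariance

open MeasureTheory Set Function Filter Topology Metric InnerProductSpace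
open scoped RealInnerProductSpace InnerProductSpace Laplacian ContDiff
open Literature.Analysis Literature.Analysis.FluidPDE
open Summit.NavierStokesRegularity.NavierStokesRegularity.Theorems.PoloidalWindowDoorPoloidalWindowRigidityWindow
open Summit.NavierStokesRegularity.NavierStokesRegularity.Theorems.PoloidalWindowDoorPoloidalWindowRigidityClassRate
open Summit.NavierStokesRegularity.NavierStokesRegularity.Theorems.PoloidalWindowDoorPoloidalWindowRigidityHorizontalMean
open Summit.NavierStokesRegularity.NavierStokesRegularity.Theorems.PoloidalWindowDoorPoloidalWindowRigidityConstantShearMeans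
open Summit.NavierStokesRegularity.NavierStokesRegularity.Theorems.PoloidalWindowDoorPoloidalWindowRigidityConstantShearEnergy
open Summit.NavierStokesRegularity.NavierStokesRegularity.Theorems.PoloidalWindowDoorPoloidalWindowRigidityConstantShearSlice

/-! ### The slice quantities as functions of `(t, z)` -/

variable (φ : ContDiffBump (0 : EuclideanSpace ℝ (Fin 2))) (R : ℝ)
  (v : ℝ → EuclideanSpace ℝ (Fin 3) → EuclideanSpace ℝ (Fin 3))

/-- Horizontal mean of `v₂` at time `t`, height `z`. -/
def sliceM (t z : ℝ) : ℝ := hmean φ 0 R z (fun x => v t x 2)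

/-- Horizontal mean of `v₂²`. -/
def sliceE (t z : ℝ) : ℝ := hmean φ 0 R z (fun x => v t x 2 ^ 2)

/-- The HORIZONTAL VARIANCE of `v₂`: `V = ⟨v₂²⟩ − ⟨v₂⟩²`. -/
def sliceV (t z : ℝ) : ℝ := sliceE φ R v t z - sliceM φ R v t z ^ 2

/-- The FLUX of the variance: `G = ½⟨v₂³⟩ − ⟨v₂⟩⟨v₂²⟩ + ½⟨v₂⟩³`. -/
def sliceG (t z : ℝ) : ℝ :=
  hmean φ 0 R z (fun x => v t x 2 ^ 3) / 2 - sliceM φ R v t z * sliceE φ R v t z + sliceM φ R v t z ^ 3 / 2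

/-- The horizontal DISSIPATION `D = ⟨|∇_h v₂|²⟩`. -/
def sliceD (t z : ℝ) : ℝ :=
  hmean φ 0 R z (fun x => fderiv ℝ (fun y => v t y 2) x (EuclideanSpace.single 0 (1 : ℝ)) ^ 2 +
    fderiv ℝ (fun y => v t y 2) x (EuclideanSpace.single 1 (1 : ℝ)) ^ 2)

/-- The value of `∂ₜV`: `⟨2v₂∂ₜv₂⟩ − 2⟨v₂⟩⟨∂ₜv₂⟩`. -/
def sliceVt (t z : ℝ) : ℝ :=
  hmean φ 0 R z (fun x => 2 * v t x 2 * deriv (fun s => v s x) t 2) -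
    2 * sliceM φ R v t z * hmean φ 0 R z (fun x => deriv (fun s => v s x) t 2)

/-- The value of `∂_zG`. -/
def sliceGz (t z : ℝ) : ℝ :=
  hmean φ 0 R z (fun x => fderiv ℝ (fun y => v t y 2 ^ 3) x (EuclideanSpace.single 2 (1 : ℝ))) / 2
    - hmean φ 0 R z (fun x => fderiv ℝ (v t) x (EuclideanSpace.single 2 (1 : ℝ)) 2) * sliceE φ R v t z
    - sliceM φ R v t z * hmean φ 0 R z (fun x => fderiv ℝ (fun y => v t y 2 ^ 2) x (EuclideanSpace.single 2 (1 : ℝ)))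
    + 3 / 2 * sliceM φ R v t z ^ 2 * hmean φ 0 R z (fun x => fderiv ℝ (v t) x (EuclideanSpace.single 2 (1 : ℝ)) 2)

variable {φ R v} {C : ℝ}

/-! ### Class bookkeeping: continuity and smoothness of `v₂`, `∂ₜv₂` -/

section Class

variable (hrate : HasTypeITimeDecay C v) (hcont : ContinuousOn (uncurry v) (Iio (0 : ℝ) ×ˢ univ))
  (hmild : ∀ s t : ℝ, s < t → t < 0 → ∀ x,
    v t x = UnboundedOperators.heatExtension (v s) (t - s) x - oseenDuhamel 1 s v v t x)
  (hdiv : ∀ t < 0, VectorCalculus.IsDivFree (v t))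

include hrate hcont hmild hdiv

omit hrate hmild hdiv in
/-- `(t,x) ↦ v₂` is continuous on the open slab. -/
theorem continuousOn_vert : ContinuousOn (uncurry fun t x => v t x 2) (Iio (0 : ℝ) ×ˢ univ) :=
  (EuclideanSpace.proj (𝕜 := ℝ) (2 : Fin 3)).continuous.comp_continuousOn hcont

/-- `(t,x) ↦ ∂ₜv₂` is continuous on the open slab. -/
theorem continuousOn_vertT :
    ContinuousOn (uncurry fun t x => deriv (fun s => v s x) t 2) (Iio (0 : ℝ) ×ˢ univ) := by
  have hA : IsTypeIAncientMild C v := isTypeIAncientMild_of_class hrate hcont hmild hdiv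
  have hsm : IsSmoothSpaceTimeOn (Iio (0 : ℝ)) v := hA.contDiffOn
  exact (EuclideanSpace.proj (𝕜 := ℝ) (2 : Fin 3)).continuous.comp_continuousOn
    (hsm.isSmoothSpaceTimeOn_deriv isOpen_Iio).continuousOn

/-- The time line `s ↦ v₂(s,x)` has derivative `(∂ₜv(t,x))₂` at `t < 0`. -/
theorem hasDerivAt_vert {t : ℝ} (ht : t < 0) (x : EuclideanSpace ℝ (Fin 3)) :
    HasDerivAt (fun s => v s x 2) (deriv (fun s => v s x) t 2) t := by
  have hA : IsTypeIAncientMild C v := isTypeIAncientMild_of_class hrate hcont hmild hdiv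
  have hsm : IsSmoothSpaceTimeOn (Iio (0 : ℝ)) v := hA.contDiffOn
  have h := hsm.hasDerivAt_timeLine isOpen_Iio ht x
  exact ((EuclideanSpace.proj (𝕜 := ℝ) (2 : Fin 3)).hasFDerivAt.comp_hasDerivAt t h)

/-- The slice `x ↦ v₂(t,x)` is `C^∞`. -/
theorem contDiff_vert {t : ℝ} (ht : t < 0) : ContDiff ℝ ∞ fun x => v t x 2 :=
  contDiff_coord ((isTypeIAncientMild_of_class hrate hcont hmild hdiv).contDiff_slice ht) 2

/-- The slice `x ↦ (∂ₜv(t,x))₂` is `C^∞`. -/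
theorem contDiff_vertT {t : ℝ} (ht : t < 0) : ContDiff ℝ ∞ fun x => deriv (fun s => v s x) t 2 :=
  contDiff_coord (contDiff_timeDeriv_slice hrate hcont hmild hdiv ht) 2

/-! ### Derivatives of the slice quantities -/

/-- `∂ₜ⟨v₂⟩ = ⟨∂ₜv₂⟩`. -/
theorem hasDerivAt_sliceM {t : ℝ} (ht : t < 0) (z : ℝ) :
    HasDerivAt (fun τ => sliceM φ R v τ z) (hmean φ 0 R z (fun x => deriv (fun s => v s x) t 2)) t :=
  hmean_hasDerivAt_time φ 0 R z isOpen_Iio ht (F := fun t x => v t x 2) (Ft := fun t x => deriv (fun s => v s x) t 2)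
    (continuousOn_vert hcont) (continuousOn_vertT hrate hcont hmild hdiv)
    (fun _ hτ x => hasDerivAt_vert hrate hcont hmild hdiv hτ x)

/-- `∂ₜ⟨v₂²⟩ = ⟨2v₂∂ₜv₂⟩`. -/
theorem hasDerivAt_sliceE {t : ℝ} (ht : t < 0) (z : ℝ) :
    HasDerivAt (fun τ => sliceE φ R v τ z) (hmean φ 0 R z (fun x => 2 * v t x 2 * deriv (fun s => v s x) t 2)) t := by
  refine hmean_hasDerivAt_time φ 0 R z isOpen_Iio ht (F := fun t x => v t x 2 ^ 2)
    (Ft := fun t x => 2 * v t x 2 * deriv (fun s => v s x) t 2) ?_ ?_ ?_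
  · exact (continuousOn_vert hcont).pow 2
  · exact (continuousOn_const.mul (continuousOn_vert hcont)).mul
      (continuousOn_vertT hrate hcont hmild hdiv)
  · intro τ hτ x
    have h1 := hasDerivAt_vert hrate hcont hmild hdiv hτ x
    have h := h1.mul h1
    have hfun : ((fun s => v s x 2) * fun s => v s x 2) = fun s => v s x 2 ^ 2 := by funext s; simp [pow_two]
    rw [hfun] at h
    refine h.congr_deriv ?_
    ring

/-- **`∂ₜV = sliceVt`.** -/
theorem hasDerivAt_sliceV {t : ℝ} (ht : t < 0) (z : ℝ) :
    HasDerivAt (fun τ => sliceV φ R v τ z) (sliceVt φ R v t z) t := by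
  have hE := hasDerivAt_sliceE (φ := φ) (R := R) hrate hcont hmild hdiv ht z
  have hM := hasDerivAt_sliceM (φ := φ) (R := R) hrate hcont hmild hdiv ht z
  have h := hE.sub (hM.pow 2)
  refine h.congr_deriv ?_
  simp only [sliceVt, sliceM, Nat.cast_ofNat]
  ring

/-- `∂_z⟨v₂⟩ = ⟨∂₂v₂⟩`, `∂_z⟨v₂²⟩ = ⟨∂₂v₂²⟩`, `∂_z⟨v₂³⟩ = ⟨∂₂v₂³⟩`. -/
theorem hasDerivAt_sliceM_height {t : ℝ} (ht : t < 0) (z : ℝ) :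
    HasDerivAt (fun ζ => sliceM φ R v t ζ)
      (hmean φ 0 R z (fun x => fderiv ℝ (v t) x (EuclideanSpace.single 2 (1 : ℝ)) 2)) z := by
  have h := hmean_hasDerivAt_height φ 0 R z ((contDiff_vert hrate hcont hmild hdiv ht).of_le (by norm_cast))
  have hud : Differentiable ℝ (v t) :=
    ((isTypeIAncientMild_of_class hrate hcont hmild hdiv).contDiff_slice ht).differentiable (by simp)
  have hfun : (fun x => fderiv ℝ (fun y => v t y 2) x (EuclideanSpace.single 2 (1 : ℝ))) =
      fun x => fderiv ℝ (v t) x (EuclideanSpace.single 2 (1 : ℝ)) 2 :=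
    funext fun x => fderiv_coord_apply (hud x) 2 _
  rw [hfun] at h
  exact h

/-- **`∂_zG = sliceGz`.** -/
theorem hasDerivAt_sliceG {t : ℝ} (ht : t < 0) (z : ℝ) :
    HasDerivAt (fun ζ => sliceG φ R v t ζ) (sliceGz φ R v t z) z := by
  have hθ : ContDiff ℝ 1 (fun y => v t y 2) := (contDiff_vert hrate hcont hmild hdiv ht).of_le (by norm_cast)
  have hT := hmean_hasDerivAt_height φ 0 R z (hθ.pow 3)
  have hE := hmean_hasDerivAt_height φ 0 R z (hθ.pow 2)
  have hM := hasDerivAt_sliceM_height (φ := φ) (R := R) hrate hcont hmild hdiv ht z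
  have h := ((hT.div_const 2).sub (hM.mul hE)).add ((hM.pow 3).div_const 2)
  refine h.congr_deriv ?_
  simp only [sliceGz, sliceE, sliceM, Nat.cast_ofNat]
  ring

/-! ### Sizes -/

/-- `V ≥ 0`. -/
theorem sliceV_nonneg {t : ℝ} (ht : t < 0) (z : ℝ) : 0 ≤ sliceV φ R v t z :=
  hmean_variance_nonneg φ 0 R z (contDiff_vert hrate hcont hmild hdiv ht).continuous

/-- `V ≤ C²/(−t)`. -/
theorem sliceV_le {t : ℝ} (ht : t < 0) (z : ℝ) : sliceV φ R v t z ≤ C ^ 2 / (-t) := by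
  have hθc := (contDiff_vert hrate hcont hmild hdiv ht).continuous
  have hE : |sliceE φ R v t z| ≤ C ^ 2 / (-t) := by
    refine abs_hmean_le φ 0 R z (F := fun x => v t x 2 ^ 2) (hθc.pow 2) fun x => ?_
    rw [abs_pow, ← sq_abs]
    have h1 : |v t x 2| ≤ C / Real.sqrt (-t) := (abs_apply_le_norm _ 2).trans (hrate t ht x)
    have h0 : 0 ≤ |v t x 2| := abs_nonneg _
    calc |(|v t x 2|)| ^ 2 = |v t x 2| ^ 2 := by rw [abs_abs]
      _ ≤ (C / Real.sqrt (-t)) ^ 2 := pow_le_pow_left₀ h0 h1 2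
      _ = C ^ 2 / (-t) := by rw [div_pow, Real.sq_sqrt (neg_pos.2 ht).le]
  unfold sliceV
  nlinarith [(abs_le.1 hE).2, sq_nonneg (sliceM φ R v t z)]

omit hrate hcont hmild hdiv in
/-- `D ≥ 0`. -/
theorem sliceD_nonneg (t z : ℝ) : 0 ≤ sliceD φ R v t z :=
  hmean_nonneg φ 0 R z fun x => by positivity

/-- **Flux bound**: `|G| ≤ (3/2)(C/√(−t)) V`. -/
theorem abs_sliceG_le {t : ℝ} (ht : t < 0) (z : ℝ) :
    |sliceG φ R v t z| ≤ 3 / 2 * (C / Real.sqrt (-t)) * sliceV φ R v t z :=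
  abs_flux_le φ 0 z (((isTypeIAncientMild_of_class hrate hcont hmild hdiv).contDiff_slice ht).of_le (by norm_cast))
    (fun x => hrate t ht x)

/-- `|∂ₜV| ≤ 4 (C/√(−t)) (C₄/((−t)√(−t)))` given the time-derivative rate `C₄`. -/
theorem abs_sliceVt_le {C₄ : ℝ} (hC₄ : ∀ t < 0, ∀ y, ‖deriv (fun τ => v τ y) t‖ ≤ C₄ / ((-t) * Real.sqrt (-t)))
    {t : ℝ} (ht : t < 0) (z : ℝ) :
    |sliceVt φ R v t z| ≤ 4 * (C / Real.sqrt (-t)) * (C₄ / ((-t) * Real.sqrt (-t))) := by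
  have hθc := (contDiff_vert hrate hcont hmild hdiv ht).continuous
  have hθtc := (contDiff_vertT hrate hcont hmild hdiv ht).continuous
  have hM₀ : ∀ x, |v t x 2| ≤ C / Real.sqrt (-t) := fun x => (abs_apply_le_norm _ 2).trans (hrate t ht x)
  have hMt : ∀ x, |deriv (fun s => v s x) t 2| ≤ C₄ / ((-t) * Real.sqrt (-t)) := fun x =>
    (abs_apply_le_norm _ 2).trans (hC₄ t ht x)
  have h0 : 0 ≤ C / Real.sqrt (-t) := (abs_nonneg _).trans (hM₀ 0)
  have h0' : 0 ≤ C₄ / ((-t) * Real.sqrt (-t)) := (abs_nonneg _).trans (hMt 0)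
  have h1 : |hmean φ 0 R z (fun x => 2 * v t x 2 * deriv (fun s => v s x) t 2)| ≤
      2 * (C / Real.sqrt (-t)) * (C₄ / ((-t) * Real.sqrt (-t))) := by
    refine abs_hmean_le φ 0 R z (F := fun x => 2 * v t x 2 * deriv (fun s => v s x) t 2)
      ((continuous_const.mul hθc).mul hθtc) fun x => ?_
    rw [abs_mul, abs_mul, abs_two]
    exact mul_le_mul (mul_le_mul_of_nonneg_left (hM₀ x) zero_le_two) (hMt x) (abs_nonneg _) (by positivity)
  have h2 : |sliceM φ R v t z| ≤ C / Real.sqrt (-t) := abs_hmean_le φ 0 R z hθc hM₀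
  have h3 : |hmean φ 0 R z (fun x => deriv (fun s => v s x) t 2)| ≤ C₄ / ((-t) * Real.sqrt (-t)) :=
    abs_hmean_le φ 0 R z hθtc hMt
  unfold sliceVt
  calc _ ≤ |hmean φ 0 R z (fun x => 2 * v t x 2 * deriv (fun s => v s x) t 2)| +
        |2 * sliceM φ R v t z * hmean φ 0 R z (fun x => deriv (fun s => v s x) t 2)| := abs_sub _ _
    _ ≤ 2 * (C / Real.sqrt (-t)) * (C₄ / ((-t) * Real.sqrt (-t))) +
        2 * (C / Real.sqrt (-t)) * (C₄ / ((-t) * Real.sqrt (-t))) := by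
        refine add_le_add h1 ?_
        rw [abs_mul, abs_mul, abs_two]
        exact mul_le_mul (mul_le_mul_of_nonneg_left h2 zero_le_two) h3 (abs_nonneg _) (by positivity)
    _ = _ := by ring

/-- `|∂_zG| ≤ 6 (C/√(−t))² (C₁/(−t))` given the gradient rate `C₁`. -/
theorem abs_sliceGz_le {C₁ : ℝ} (hC₁ : ∀ t < 0, ∀ y, ‖fderiv ℝ (v t) y‖ ≤ C₁ / (-t)) {t : ℝ} (ht : t < 0) (z : ℝ) :
    |sliceGz φ R v t z| ≤ 6 * (C / Real.sqrt (-t)) ^ 2 * (C₁ / (-t)) := by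
  have hA : IsTypeIAncientMild C v := isTypeIAncientMild_of_class hrate hcont hmild hdiv
  have hud : Differentiable ℝ (v t) := (hA.contDiff_slice ht).differentiable (by simp)
  have hθ := contDiff_vert hrate hcont hmild hdiv ht
  have hθc := hθ.continuous
  have hθd : Differentiable ℝ (fun y => v t y 2) := hθ.differentiable (by simp)
  set M₀ := C / Real.sqrt (-t) with hM₀def
  set M₁ := C₁ / (-t) with hM₁def
  have hM₀ : ∀ x, |v t x 2| ≤ M₀ := fun x => (abs_apply_le_norm _ 2).trans (hrate t ht x)
  have hM₁ : ∀ x, |fderiv ℝ (v t) x (EuclideanSpace.single 2 (1 : ℝ)) 2| ≤ M₁ := fun x => abs_fderiv_single_le (hC₁ t ht) x 2 2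
  have h0 : 0 ≤ M₀ := (abs_nonneg _).trans (hM₀ 0)
  have h1 : 0 ≤ M₁ := (abs_nonneg _).trans (hM₁ 0)
  -- the five factors
  have eT : |hmean φ 0 R z (fun x => fderiv ℝ (fun y => v t y 2 ^ 3) x (EuclideanSpace.single 2 (1 : ℝ)))| ≤
      3 * M₀ ^ 2 * M₁ := by
    refine abs_hmean_le φ 0 R z (F := fun x => fderiv ℝ (fun y => v t y 2 ^ 3) x (EuclideanSpace.single 2 (1 : ℝ)))
      (((hθ.pow 3).continuous_fderiv (by simp)).clm_apply continuous_const) fun x => ?_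
    rw [fderiv_cube_apply (hθd x), fderiv_coord_apply (hud x) 2, abs_mul, abs_mul, abs_pow, abs_of_pos (by norm_num : (0:ℝ) < 3)]
    exact mul_le_mul (mul_le_mul_of_nonneg_left (pow_le_pow_left₀ (abs_nonneg _) (hM₀ x) 2) (by norm_num)) (hM₁ x)
      (abs_nonneg _) (by positivity)
  have eE : |hmean φ 0 R z (fun x => fderiv ℝ (fun y => v t y 2 ^ 2) x (EuclideanSpace.single 2 (1 : ℝ)))| ≤
      2 * M₀ * M₁ := by
    refine abs_hmean_le φ 0 R z (F := fun x => fderiv ℝ (fun y => v t y 2 ^ 2) x (EuclideanSpace.single 2 (1 : ℝ)))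
      (((hθ.pow 2).continuous_fderiv (by simp)).clm_apply continuous_const) fun x => ?_
    rw [fderiv_sq_apply (hθd x), fderiv_coord_apply (hud x) 2, abs_mul, abs_mul, abs_two]
    exact mul_le_mul (mul_le_mul_of_nonneg_left (hM₀ x) zero_le_two) (hM₁ x) (abs_nonneg _) (by positivity)
  have eZ : |hmean φ 0 R z (fun x => fderiv ℝ (v t) x (EuclideanSpace.single 2 (1 : ℝ)) 2)| ≤ M₁ :=
    abs_hmean_le φ 0 R z (F := fun x => fderiv ℝ (v t) x (EuclideanSpace.single 2 (1 : ℝ)) 2)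
      ((contDiff_one_fderiv_apply ((hA.contDiff_slice ht).of_le (by norm_cast)) _ 2).continuous) hM₁
  have eM : |sliceM φ R v t z| ≤ M₀ := abs_hmean_le φ 0 R z hθc hM₀
  have eS : |sliceE φ R v t z| ≤ M₀ ^ 2 := by
    refine abs_hmean_le φ 0 R z (F := fun x => v t x 2 ^ 2) (hθc.pow 2) fun x => ?_
    rw [abs_pow]; exact pow_le_pow_left₀ (abs_nonneg _) (hM₀ x) 2
  unfold sliceGz
  set Tz := hmean φ 0 R z (fun x => fderiv ℝ (fun y => v t y 2 ^ 3) x (EuclideanSpace.single 2 (1 : ℝ)))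
  set Ez := hmean φ 0 R z (fun x => fderiv ℝ (fun y => v t y 2 ^ 2) x (EuclideanSpace.single 2 (1 : ℝ)))
  set mz := hmean φ 0 R z (fun x => fderiv ℝ (v t) x (EuclideanSpace.single 2 (1 : ℝ)) 2)
  set m := sliceM φ R v t z
  set E := sliceE φ R v t z
  calc |Tz / 2 - mz * E - m * Ez + 3 / 2 * m ^ 2 * mz|
      ≤ |Tz| / 2 + |mz| * |E| + |m| * |Ez| + 3 / 2 * |m| ^ 2 * |mz| := by
        have a1 : |Tz / 2| = |Tz| / 2 := by rw [abs_div, abs_two]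
        have a2 : |mz * E| = |mz| * |E| := abs_mul _ _
        have a3 : |m * Ez| = |m| * |Ez| := abs_mul _ _
        have a4 : |3 / 2 * m ^ 2 * mz| = 3 / 2 * |m| ^ 2 * |mz| := by
          rw [abs_mul, abs_mul, abs_pow, abs_of_pos (by norm_num : (0:ℝ) < 3 / 2)]
        calc _ ≤ |Tz / 2 - mz * E - m * Ez| + |3 / 2 * m ^ 2 * mz| := abs_add_le _ _
          _ ≤ |Tz / 2 - mz * E| + |m * Ez| + |3 / 2 * m ^ 2 * mz| := by linarith [abs_sub (Tz / 2 - mz * E) (m * Ez)]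
          _ ≤ |Tz / 2| + |mz * E| + |m * Ez| + |3 / 2 * m ^ 2 * mz| := by linarith [abs_sub (Tz / 2) (mz * E)]
          _ = _ := by rw [a1, a2, a3, a4]
    _ ≤ 3 * M₀ ^ 2 * M₁ / 2 + M₁ * M₀ ^ 2 + M₀ * (2 * M₀ * M₁) + 3 / 2 * M₀ ^ 2 * M₁ := by
        gcongr
    _ = 6 * M₀ ^ 2 * M₁ := by ring

omit hrate hcont hmild hdiv in
/-- Continuity in the height of a horizontal mean of a `C¹` function. -/
theorem continuous_hmean_height (c : EuclideanSpace ℝ (Fin 3)) {F : EuclideanSpace ℝ (Fin 3) → ℝ}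
    (hF : ContDiff ℝ 1 F) : Continuous fun ζ => hmean φ c R ζ F :=
  continuous_iff_continuousAt.2 fun ζ => (hmean_hasDerivAt_height φ c R ζ hF).continuousAt

/-- `V(t,·)`, `∂ₜV(t,·)`, `G(t,·)`, `∂_zG(t,·)` are continuous in the height. -/
theorem continuous_slices {t : ℝ} (ht : t < 0) :
    Continuous (fun ζ => sliceV φ R v t ζ) ∧ Continuous (fun ζ => sliceVt φ R v t ζ) ∧
      Continuous (fun ζ => sliceG φ R v t ζ) ∧ Continuous (fun ζ => sliceGz φ R v t ζ) := by
  have hA : IsTypeIAncientMild C v := isTypeIAncientMild_of_class hrate hcont hmild hdiv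
  have hv1 : ContDiff ℝ 1 (v t) := (hA.contDiff_slice ht).of_le (by norm_cast)
  have hθ : ContDiff ℝ 1 (fun y => v t y 2) := (contDiff_vert hrate hcont hmild hdiv ht).of_le (by norm_cast)
  have hθ2 : ContDiff ℝ 2 (fun y => v t y 2) := (contDiff_vert hrate hcont hmild hdiv ht).of_le (by norm_cast)
  have hθt : ContDiff ℝ 1 (fun y => deriv (fun s => v s y) t 2) :=
    (contDiff_vertT hrate hcont hmild hdiv ht).of_le (by norm_cast)
  have cM : Continuous fun ζ => sliceM φ R v t ζ := continuous_hmean_height (φ := φ) (R := R) 0 hθ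
  have cE : Continuous fun ζ => sliceE φ R v t ζ := continuous_hmean_height (φ := φ) (R := R) 0 (hθ.pow 2)
  have cT : Continuous fun ζ => hmean φ 0 R ζ (fun x => v t x 2 ^ 3) :=
    continuous_hmean_height (φ := φ) (R := R) 0 (hθ.pow 3)
  have cP : Continuous fun ζ => hmean φ 0 R ζ (fun x => 2 * v t x 2 * deriv (fun s => v s x) t 2) :=
    continuous_hmean_height (φ := φ) (R := R) 0 ((contDiff_const.mul hθ).mul hθt)
  have cMt : Continuous fun ζ => hmean φ 0 R ζ (fun x => deriv (fun s => v s x) t 2) :=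
    continuous_hmean_height (φ := φ) (R := R) 0 hθt
  have cTz : Continuous fun ζ => hmean φ 0 R ζ (fun x => fderiv ℝ (fun y => v t y 2 ^ 3) x (EuclideanSpace.single 2 (1 : ℝ))) :=
    continuous_hmean_height (φ := φ) (R := R) 0 (((hθ2.pow 3).fderiv_right (m := 1) (by norm_cast)).clm_apply contDiff_const)
  have cEz : Continuous fun ζ => hmean φ 0 R ζ (fun x => fderiv ℝ (fun y => v t y 2 ^ 2) x (EuclideanSpace.single 2 (1 : ℝ))) :=
    continuous_hmean_height (φ := φ) (R := R) 0 (((hθ2.pow 2).fderiv_right (m := 1) (by norm_cast)).clm_apply contDiff_const)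
  have cmz : Continuous fun ζ => hmean φ 0 R ζ (fun x => fderiv ℝ (v t) x (EuclideanSpace.single 2 (1 : ℝ)) 2) :=
    continuous_hmean_height (φ := φ) (R := R) 0
      (contDiff_one_fderiv_apply ((hA.contDiff_slice ht).of_le (by norm_cast)) _ 2)
  refine ⟨?_, ?_, ?_, ?_⟩
  · unfold sliceV; exact cE.sub (cM.pow 2)
  · unfold sliceVt; exact cP.sub ((continuous_const.mul cM).mul cMt)
  · unfold sliceG; exact ((cT.div_const 2).sub (cM.mul cE)).add ((cM.pow 3).div_const 2)
  · unfold sliceGz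
    exact (((cTz.div_const 2).sub (cmz.mul cE)).sub (cM.mul cEz)).add ((continuous_const.mul (cM.pow 2)).mul cmz)

/-! ### The KEY inequality on the stratum -/

/-- **KEY INEQUALITY ON THE CONSTANT-SHEAR STRATUM.**  For a profile of the class, poloidal, with constant proportional
shear `∂₂v_b = μ ∂_b v₂` (`b = 0,1`, `μ ≠ 1`) on every slice, and gradient rate `C₁`: for every `t < 0`, `z`, `R > 0`,
`∂ₜV + 2∂_zG + 2(1−μ)D ≤ R⁻¹ (8M₀³ + (4 + 2|1−μ|)M₀M₁)(‖∂₀φ̄‖₁+‖∂₁φ̄‖₁)`, `M₀ = C/√(−t)`, `M₁ = C₁/(−t)`.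
The Navier–Stokes residual enters only through K2-p3's separated pressure (`f₂` depends on the height alone). -/
theorem key_slice (hpol : ∀ s < 0, ∀ y, ⟪curl (v s) y, EuclideanSpace.single 2 1⟫_ℝ = 0) {μ : ℝ} (hμ : μ ≠ 1)
    (hslope : ∀ s < 0, ∀ y, ∀ b : Fin 3, b ≠ 2 →
      fderiv ℝ (v s) y (EuclideanSpace.single 2 1) b = μ * fderiv ℝ (v s) y (EuclideanSpace.single b 1) 2)
    {C₁ : ℝ} (hC₁ : ∀ t < 0, ∀ y, ‖fderiv ℝ (v t) y‖ ≤ C₁ / (-t)) (hR : 0 < R) {t : ℝ} (ht : t < 0) (z : ℝ) :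
    sliceVt φ R v t z + 2 * sliceGz φ R v t z + 2 * (1 - μ) * sliceD φ R v t z ≤
      R⁻¹ * (8 * (C / Real.sqrt (-t) * (C / Real.sqrt (-t)) * (C / Real.sqrt (-t))) +
        (4 + 2 * |1 - μ|) * (C / Real.sqrt (-t) * (C₁ / (-t)))) * bumpK φ := by
  have hA : IsTypeIAncientMild C v := isTypeIAncientMild_of_class hrate hcont hmild hdiv
  have hu : ContDiff ℝ 2 (v t) := (hA.contDiff_slice ht).of_le (by norm_cast)
  have hdiv' := fun x => div_coord (hdiv t ht) x
  have hθt := (contDiff_vertT hrate hcont hmild hdiv ht).continuous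
  -- the vertical momentum equation with the height-only source
  set g : ℝ → ℝ := fun ζ => (timeDerivWithin (Iio 0) v t (ζ • EuclideanSpace.single 2 (1 : ℝ)) +
    convect (v t) (v t) (ζ • EuclideanSpace.single 2 (1 : ℝ)) - Δ (v t) (ζ • EuclideanSpace.single 2 (1 : ℝ))) 2 with hg
  have heq : ∀ x, deriv (fun s => v s x) t 2 + fderiv ℝ (fun y => v t y 2) x (v t x) -
      ∑ i : Fin 3, fderiv ℝ (fun y => fderiv ℝ (fun y' => v t y' 2) y (EuclideanSpace.single i (1 : ℝ))) x
        (EuclideanSpace.single i (1 : ℝ)) = g (x 2) := by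
    intro x
    rw [← (hasDerivAt_vert hrate hcont hmild hdiv ht x).deriv, vertical_equation_coord hrate hcont hmild hdiv ht x, hg]
    exact residual_vert_eq_of_height_eq hrate hcont hmild hdiv hpol hμ hslope ht (by simp)
  have hwave := fun x => wave_identity hu hdiv' (hslope t ht) x
  have key := key_mean φ 0 z hu hdiv' (fun x => hrate t ht x) (hC₁ t ht) hθt heq hwave hR
  unfold sliceVt sliceGz sliceD sliceM sliceE
  exact key

end Class

end Summit.NavierStokesRegularity.NavierStokesRegularity.Theorems.PoloidalWindowDoorPoloidalWindowRigidityConstantShearVariance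

end
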